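import Literature.AlgebraicGeometry.HodgeTheory.HodgeLocus
import Literature.AlgebraicGeometry.HodgeTheory.DirectImageCovering
import Literature.AlgebraicGeometry.HodgeTheory.GlobalInvariantCycles
import Literature.AlgebraicGeometry.HodgeTheory.ComplexGysinCorrespondence
import Literature.AlgebraicGeometry.HodgeTheory.ComplexOrientationFamily
import Literature.AlgebraicGeometry.Motives.FamiliesVHS
import Literature.AlgebraicGeometry.Motives.AlgPoints

/-!
# Route MarkmanPartnerTransport · crux `LowPicardRealMultiplication` (stmt-HodgeConjecture-19653) —
# the input structure of an `X`-side spread line for `K3^{[2]}`-type fourfolds (definitions only)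

Twin of `Theorems/MarkmanPartnerTransportRMSpreadDefs` (`RMSpreadFamily S hS t`, K3 squares) for the
partner-free residue of the route's target: a smooth projective FOURFOLD `X` and an endomorphism `t` of
`H²(X(ℂ); ℂ)` (in the application: `X` of `K3^{[2]}`-type with real multiplication, `ρ(X) ≤ 3`, `t` a
generator of `E = End_Hdg T(X)_ℚ`). The consumer
(`Theorems/MarkmanPartnerTransportK3Sq2TypeHodgeOfHKSpread`) combines it with the `X`-side rung F4
`hodgeConjectureFor_of_cycleInducedGenerator` (prover 19652-p1 g7): a spread family makes `t` CYCLE-INDUCED,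
hence HC⁴(X) modulo {Verbitsky–Guan, O'Grady, Charles–Markman}.

`HKSpreadFamily X hX t` — **a spread family for `(X, t)`**: a smooth projective family `g : 𝒳 → B` with
quasi-projective total space over a smooth IRREDUCIBLE quasi-projective base (intended: the fibre square of the
universal family over a neat-level cover of the irreducible component, through `X`, of the real-multiplication
locus of a lattice-polarised moduli space of `K3^{[2]}`-type fourfolds — Verbitsky/Markman Torelli, Viehweg;
algebraic by Cattani–Deligne–Kaplan), a point `b₁` with `X ⊗ X ≅ 𝒳_{b₁}`, a CONTINUOUS SECTION `σ` of the
espace étalé `FiberClass g 8` of `R⁸ g_* ℂ` (a flat section: the class inducing the generator,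
monodromy-invariant after a finite base change) whose value at `b₁`, pulled back to `X ⊗ X`, induces `t` as the
correspondence `[Z]_* = pr₁_*(pr₂^*(–) ∪ Z)` (`corrAction` for the complex orientations), and a DOMINANT morphism
`c : V → B` from an irreducible separated `ℂ`-scheme locally of finite type, non-empty, such that the value of
`σ` over `c(v)` is an ALGEBRAIC class (`∈ A⁴`) for every `v ∈ V(ℂ)` (intended: the classifying morphism of an
explicit family of fourfolds carrying the generator as a cycle — e.g. Hilbert squares over a maximal
van Geemen–Schütt family, Thm. 1.1 (11): `ρ(S) = 2`, `ρ(S^{[2]}) = 3`).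

Nothing is asserted: one structure, no instance, no notation, no axiom, no sorry; NOT claimed inhabited for any
`X`. Prover seat hodge-nonav-19652-p1 (gen 7), `--supports stmt-HodgeConjecture-19653`.

References: van Geemen–Schütt, Forum Math. Sigma 13 (2025) e2, §3.4, Thm. 1.1 (11), §4.8; E. Markman, Compos.
Math. 160 (2024) Thm. 1.1; Voisin, *Hodge Theory II* (2003), Thm. 4.18, §7.3.2; Cattani–Deligne–Kaplan, JAMS 8
(1995), Cor. 1.2.
-/

set_option linter.dupNamespace false

noncomputable section

namespace Summit.HodgeConjecture.HodgeConjecture.Theorems.MarkmanPartnerTransport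

open CategoryTheory MonoidalCategory CartesianMonoidalCategory AlgebraicGeometry
open Literature.AlgebraicGeometry Literature.AlgebraicGeometry.Motives Literature.AlgebraicGeometry.HodgeTheory
open Literature.AlgebraicTopology.SingularHomology

/-- **A spread family for the pair `(X, t)`** (`X` a smooth projective fourfold, `t` an endomorphism of
`H²(X(ℂ); ℂ)` — in the application a generator of the real-multiplication field of a `K3^{[2]}`-type fourfold):
a smooth projective family `family : total ⟶ base` with quasi-projective total space over a smooth irreducible
quasi-projective base; a complex point `pt₁` with an isomorphism `fibreIso : X ⊗ X ≅ 𝒳_{pt₁}`; a continuous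
section `flatSection` of the espace étalé `FiberClass family 8` of `R⁸ family_* ℂ` whose value at `pt₁`,
transported along `fibreIso`, INDUCES `t`: `t y = [Z]_* y = pr₁_*(pr₂^* y ∪ Z)` for the complex orientations,
`Z = fibreIso^*(flatSection pt₁)`; and a dominant morphism `classify : param ⟶ base` from an irreducible,
separated, non-empty `ℂ`-scheme locally of finite type such that the value of `flatSection` over `classify v` is
an algebraic class (`∈ N⁴H⁸`) for every complex point `v` of `param`. Twin of `RMSpreadFamily` (K3 squares).
[cite: GeemenSchutt2023, §3.4, Thm. 1.1 (11) and §4.8] [cite: VoisinHodgeII2003, §5.3.1 and §7.3.2]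
[cite: CattaniDeligneKaplan1995JAMS, Cor. 1.2] -/
structure HKSpreadFamily (X : SchemeOver ℂ) (hX : IsSmoothProjective 4 X)
    (t : complexBetti X 2 →ₗ[ℂ] complexBetti X 2) where
  /-- The base `B` of the family (intended: a neat-level cover of the RM component through `X`). -/
  base : SchemeOver ℂ
  /-- The total space `𝒳` of the family (intended: the fibre square of the universal family). -/
  total : SchemeOver ℂ
  /-- The family `g : 𝒳 ⟶ B`. -/
  family : total ⟶ base
  /-- The relative dimension of the family (`8` in the intended instance; not constrained). -/
  relDim : ℕ
  /-- `g` is a smooth projective family of relative dimension `relDim`. -/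
  isSmoothProjectiveFamily : IsSmoothProjectiveFamily family relDim
  /-- The total space is quasi-projective over `ℂ`. -/
  total_quasiProjective : IsQuasiProjectiveOver total
  /-- The base is quasi-projective over `ℂ`. -/
  base_quasiProjective : IsQuasiProjectiveOver base
  /-- The base is smooth over `ℂ`. -/
  base_smooth : AlgebraicGeometry.Smooth base.hom
  /-- The base is irreducible. -/
  base_irreducible : IrreducibleSpace base.left
  /-- The flat family of degree-`8` fibre classes: a section of the espace étalé of `R⁸ g_* ℂ`. -/
  flatSection : ComplexPoints base → FiberClass family (2 * 4)
  /-- The section is continuous (i.e. flat). -/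
  flatSection_continuous : Continuous flatSection
  /-- The section is a section of `FiberClass.pt`. -/
  flatSection_pt : ∀ b, (flatSection b).pt = b
  /-- The complex point of the base under `X ⊗ X`. -/
  pt₁ : ComplexPoints base
  /-- The identification of `X ⊗ X` with the fibre over `pt₁`. -/
  fibreIso : X ⊗ X ≅ fiberOver family pt₁
  /-- The value of the section at `pt₁`, pulled back to `X ⊗ X`, induces `t` as the correspondence
  `y ↦ pr₁_*(pr₂^* y ∪ Z)` for the complex orientations (`corrAction`). -/
  induces : ∀ y : complexBetti X 2,
    t y = corrAction complexOrientationFamily hX hX (rfl : 2 + 2 * 4 = 2 + 2 * 4)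
      (complexBetti.map fibreIso.hom (2 * 4) ((flatSection pt₁).clsAt (flatSection_pt pt₁))) y
  /-- The parameter scheme `V` of the cycle-carrying family. -/
  param : SchemeOver ℂ
  /-- The classifying morphism `c : V ⟶ B`. -/
  classify : param ⟶ base
  /-- `V` is irreducible. -/
  param_irreducible : IrreducibleSpace param.left
  /-- `V` is separated over `ℂ`. -/
  param_isSeparated : IsSeparated param.hom
  /-- `V` is locally of finite type over `ℂ`. -/
  param_locallyOfFiniteType : LocallyOfFiniteType param.hom
  /-- `V` has a complex point. -/
  param_nonempty : Nonempty (ComplexPoints param)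
  /-- `c` is dominant (dense image). -/
  classify_denseRange : DenseRange classify.left.base
  /-- Over every complex point of `V` the value of the section is an algebraic class. -/
  algebraic_over_param : ∀ v : ComplexPoints param,
    (flatSection (AlgPoints.map classify v)).clsAt (flatSection_pt _) ∈
      algebraicClasses (fiberOver family (AlgPoints.map classify v)) 4

end Summit.HodgeConjecture.HodgeConjecture.Theorems.MarkmanPartnerTransport
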